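import Mathlib
import Literature.Analysis.FluidPDE.Tao2016AveragedNS.RenormalisedCascadeWaves
import Literature.Analysis.FluidPDE.Tao2016AveragedNS.ViscousEternalSolutions
import Literature.Analysis.FluidPDE.Tao2016AveragedNS.BoundedEternalSolutions
import Summits.NavierStokesRegularity.NavierStokesRegularity.Theses.TaoLadderRungTwoBreak
import Summits.NavierStokesRegularity.NavierStokesRegularity.Theorems.TaoLadderRungTwoBreakNoSurvivingEternalViscBddOneTwinRotorEmbedding
import Summits.NavierStokesRegularity.NavierStokesRegularity.Theorems.TaoLadderRungTwoBreakNoSurvivingEternalViscBddOneRankOneShadow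
import HarnessLib

/-!
# Route TaoLadderRungTwoBreak — BY NAME: the K1-type predicates at every spread `R ≥ 1` govern ALL rank-one
# (polarised) admissible eternal solutions of ALL cancelling tables
# (`--supports` stmt-NavierStokesRegularity-20419; part 3 of 3 — thin glue over `…RankOneShadow` and `…TwinRotorEmbedding`)

MODEL lattice (Tao 2016 §4) only; nothing here is a statement about the Navier–Stokes equations; no stub,
crux, rung or summit is proved by this file.

Composition of two landed reductions: the twin-rotor embedding (`…TwinRotorEmbedding`: for every `R ≥ 1`,
`NoSurvivingEternalViscBdd R a` / `NoSurvivingEternalBdd R a` ⟹ their dyadic slices, since the dyadic chain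
lives diagonally in the spread-one twin-rotor table) and the rank-one dichotomy (`…RankOneShadow`: the dyadic
slice at `(ε₀, a)` ⟹ the same exclusion for rank-one solutions `W_n = c_n·v` of EVERY cancelling
`Fin 4`-table, the inviscid version without any uniform bound).  Hence, for every `R ≥ 1`:

* `rankOne_of_noSurvivingEternalViscBdd`: `NoSurvivingEternalViscBdd R a` ⟹ rank-one K1ᵛ for all cancelling
  tables (any spread, symmetric or not);
* `rankOne_of_noSurvivingEternalBdd`: `NoSurvivingEternalBdd R a` ⟹ rank-one inviscid Liouville for all
  cancelling tables, WITHOUT the uniform bound;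
* the crux ⟨20419⟩ `NoSurvivingEternalViscBddOne` and the route decl (ρ0) `NoSurvivingEternalBddOne` (registered
  stub `stub_noSurvivingEternalBddOne`) likewise at `a = 1` (`rankOne_of_NoSurvivingEternalViscBddOne`,
  `rankOne_of_NoSurvivingEternalBddOne`).

READING for the census of ⟨20419⟩/⟨20205⟩: the polarised sector of «∀ R ≥ 1, ∀ α ∈ E₂(R)» is exactly the dyadic
wake law W1-dyadic (no table- or spread-dependence); HONEST LABEL: glue; every stub of ⟨20419⟩, ⟨20420⟩,
⟨20205⟩ remains OPEN.
-/

noncomputable section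

-- the sub-problem namespace repeats the summit name by design (D-0017)
set_option linter.dupNamespace false

namespace Summit.NavierStokesRegularity.NavierStokesRegularity.Theorems.TaoLadderRungTwoBreakRankOne

open Literature.Analysis.FluidPDE Literature.Analysis.FluidPDE.TaoCascade
open Summit.NavierStokesRegularity.NavierStokesRegularity.Theorems.TaoLadderRungTwoBreakTwinRotor
  (dyadic_of_noSurvivingEternalViscBdd dyadic_of_noSurvivingEternalBdd)

/-! ## By name: the K1-type predicates at every spread `R ≥ 1` govern all rank-one solutions -/

section ByName

/-- **`NoSurvivingEternalViscBdd R a` (K1ᵛ-type, ANY `R ≥ 1`) ⟹ the rank-one K1ᵛ for EVERY cancelling table**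
(any spread, symmetric or not): through the twin-rotor embedding (dyadic slice) and the dyadic shadow.
[cite: Tao2016AveragedNS, §1.2, §4 (4.3), Thm. 4.2 (statement shape), the viscous equation before it, §6.4; cell vocabulary (`NoSurvivingEternalViscBdd`)] -/
theorem rankOne_of_noSurvivingEternalViscBdd {R a : ℝ} (hR : 1 ≤ R) (h : NoSurvivingEternalViscBdd R a) :
    ∃ εs : ℝ, 0 < εs ∧ ∀ ε₀ : ℝ, 0 < ε₀ → ε₀ ≤ εs →
      ∀ α : Fin 4 → Fin 4 → Fin 4 → ℤ × ℤ × ℤ → ℝ, IsCancellingCoeff α →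
        ∀ (νh : ℝ) (W : ℤ → ℝ → Em 4) (v : Em 4) (c : ℤ → ℝ → ℝ), v ≠ 0 →
          (∀ n σ, W n σ = c n σ • v) → IsEternalVisc ε₀ νh α W → UniformBound W →
            ¬ EternalSurvivingFwd a ε₀ W := by
  obtain ⟨εs, hεs, H⟩ := dyadic_of_noSurvivingEternalViscBdd hR h
  refine ⟨εs, hεs, fun ε₀ hε hle α hc νh W v c hv hWv hW hU => ?_⟩
  exact rankOne_not_surviving_of_dyadic hε (fun U hU' hB => H ε₀ hε hle νh U hU' hB) hc hv hWv hW hU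

/-- **`NoSurvivingEternalBdd R a` ((ρ0)-type, ANY `R ≥ 1`) ⟹ the rank-one inviscid Liouville for EVERY
cancelling table, WITHOUT the uniform bound.**
[cite: Tao2016AveragedNS, §1.2, §4 (4.3), Thm. 4.2 (statement shape), §6.4; cell vocabulary (`NoSurvivingEternalBdd`)] -/
theorem rankOne_of_noSurvivingEternalBdd {R a : ℝ} (hR : 1 ≤ R) (h : NoSurvivingEternalBdd R a) :
    ∃ εs : ℝ, 0 < εs ∧ ∀ ε₀ : ℝ, 0 < ε₀ → ε₀ ≤ εs →
      ∀ α : Fin 4 → Fin 4 → Fin 4 → ℤ × ℤ × ℤ → ℝ, IsCancellingCoeff α →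
        ∀ (W : ℤ → ℝ → Em 4) (v : Em 4) (c : ℤ → ℝ → ℝ), v ≠ 0 →
          (∀ n σ, W n σ = c n σ • v) → IsEternal ε₀ α W → ¬ EternalSurvivingFwd a ε₀ W := by
  obtain ⟨εs, hεs, H⟩ := dyadic_of_noSurvivingEternalBdd hR h
  refine ⟨εs, hεs, fun ε₀ hε hle α hc W v c hv hWv hW => ?_⟩
  exact rankOne_not_surviving_of_dyadic_inviscid hε (fun U hU' => H ε₀ hε hle U hU') hc hv hWv hW

/-- **The crux ⟨20419⟩ `NoSurvivingEternalViscBddOne` ⟹ rank-one K1ᵛ at `a = 1` for every cancelling table.**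
[cite: Tao2016AveragedNS, §4 Thm. 4.2 (statement shape), §6.4; cell vocabulary (stmt-NavierStokesRegularity-20419)] -/
theorem rankOne_of_NoSurvivingEternalViscBddOne
    (h : Summit.NavierStokesRegularity.NavierStokesRegularity.Theses.TaoLadderRungTwoBreak.NoSurvivingEternalViscBddOne) :
    ∃ εs : ℝ, 0 < εs ∧ ∀ ε₀ : ℝ, 0 < ε₀ → ε₀ ≤ εs →
      ∀ α : Fin 4 → Fin 4 → Fin 4 → ℤ × ℤ × ℤ → ℝ, IsCancellingCoeff α →
        ∀ (νh : ℝ) (W : ℤ → ℝ → Em 4) (v : Em 4) (c : ℤ → ℝ → ℝ), v ≠ 0 →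
          (∀ n σ, W n σ = c n σ • v) → IsEternalVisc ε₀ νh α W → UniformBound W →
            ¬ EternalSurvivingFwd 1 ε₀ W :=
  rankOne_of_noSurvivingEternalViscBdd le_rfl (h 1 le_rfl)

/-- **(ρ0) `NoSurvivingEternalBddOne` (the registered stub `stub_noSurvivingEternalBddOne` of ⟨20419⟩, by the
route decl) ⟹ rank-one inviscid Liouville at `a = 1` for every cancelling table, no uniform bound needed.**
[cite: Tao2016AveragedNS, §4 Thm. 4.2 (statement shape), §6.4; cell vocabulary (stmt-NavierStokesRegularity-20451)] -/
theorem rankOne_of_NoSurvivingEternalBddOne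
    (h : Summit.NavierStokesRegularity.NavierStokesRegularity.Theses.TaoLadderRungTwoBreak.NoSurvivingEternalBddOne) :
    ∃ εs : ℝ, 0 < εs ∧ ∀ ε₀ : ℝ, 0 < ε₀ → ε₀ ≤ εs →
      ∀ α : Fin 4 → Fin 4 → Fin 4 → ℤ × ℤ × ℤ → ℝ, IsCancellingCoeff α →
        ∀ (W : ℤ → ℝ → Em 4) (v : Em 4) (c : ℤ → ℝ → ℝ), v ≠ 0 →
          (∀ n σ, W n σ = c n σ • v) → IsEternal ε₀ α W → ¬ EternalSurvivingFwd 1 ε₀ W :=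
  rankOne_of_noSurvivingEternalBdd le_rfl (h 1 le_rfl)

end ByName

end Summit.NavierStokesRegularity.NavierStokesRegularity.Theorems.TaoLadderRungTwoBreakRankOne

end
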